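import Summits.ValiantsHypothesis.ValiantsHypothesis.Theorems.KPlusLogSqLawWeakLiftingTowerGraftTwoSidedClusteredUppers

/-!
# Tower graft line — the MIRROR of the clustered law: PSD letters clustered BELOW the pivot (part H of the two-sided series)

Crux `stmt-ValiantsHypothesis-19561`, line (B) `tower_graft`, two-sided word instrument; seat val-sym-lift-p3 g20, `--supports 19561`,
NO stub claimed.  Part F bounded the ENTERING-type roots of a word with several PSD letters clustered ABOVE the pivot by the rank of the
bottom letter.  Reflecting `t ↦ 1/t` gives the mirror: several PSD letters clustered BELOW the pivot (each no farther below it than the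
top letter is above) and one PSD letter `C` on top — then the EXITING (positive-type) roots number at most `rank C`.  Typed here as the
four-letter instance `card_posType_le_rank_four_letters_lower` for the reduced pencil `P₁ + τP₂ + τ²J + τ⁴C` (supports
`(d₀, d₀+g, d₀+2g, d₀+4g)`, e.g. `(0,1,2,4)`), a direct corollary of part F's `card_negType_le_rank_four_letters` at the nodes `τᵢ⁻¹`.
With `P₁ ≻ 0`, `C ≻ 0` and definite-type roots the global index formula again gives `Z₊ = 2N⁺ ≤ 2m` (census wrapper not typed).
LOCATED (this seat, exact): `(0,1,2,4)`: `4 = 2m` at `m = 2`, `6 = 2m` at `m = 3`; `(0,1,2,3)` (pivot at `2`): `6 = 2m` at `m = 3`;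
control `(0,2,3,4)` read with the pivot at `3` (lower gap `3 >` top gap `1`): `6 > 2m` at `m = 2`.
HONEST FRAMING: clustered supports, not towers; nothing on the tower column, S4…S5, `TowerB`, `WeakLifting` in its window,
Conjecture B, 18050 or `VP ≠ VNP`.  Def-free; axioms standard.

[folklore] reflection of part F.
-/

set_option linter.dupNamespace false
set_option autoImplicit false

namespace Summit.ValiantsHypothesis.ValiantsHypothesis.Theorems.KPlusLogSqLaw.TowerGraft

open Matrix
open scoped BigOperators

namespace TwoSidedThree

/-! ## §8 The MIRROR of the clustered law: PSD letters clustered BELOW the pivot, one PSD letter on top -/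

section ClusteredLower

variable {m : ℕ} {I : Type} [Fintype I] [DecidableEq I]

/-- **MIRROR FOUR-LETTER LAW (clustered lower letters; reflection `t ↦ 1/t` of `card_negType_le_rank_four_letters`).**
Reduced pencil `P₁ + τ P₂ + τ² J + τ⁴ C` (supports `(d₀, d₀+g, d₀+2g, d₀+4g)`, e.g. `(0,1,2,4)`): two PSD letters BELOW the pivot at
gaps `2, 1 ≤` the top gap `2`, one PSD letter `C` on top, `J` ANY symmetric.  Then the kernel pairs of POSITIVE (exiting) type —
`2⟨u,P₁u⟩ + τ⟨u,P₂u⟩ < 2τ⁴⟨u,Cu⟩`, i.e. the Rayleigh polynomial is INCREASING at its root — at distinct positive scales number at most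
`rank C ≤ m`.  (Located maxima of the word on `(0,1,2,4)`: `4 = 2m` at `m = 2`, `6 = 2m` at `m = 3`; on `(0,2,3,4)` read with the pivot
at `3` — lower gap `3 >` top gap `1` — the count is `6 > 2m` at `m = 2`.) [folklore] -/
theorem card_posType_le_rank_four_letters_lower (P₁ P₂ J C : Matrix (Fin m) (Fin m) ℝ) (τ : I → ℝ) (u : I → Fin m → ℝ)
    (hP₁ : P₁.PosSemidef) (hP₂ : P₂.PosSemidef) (hJ : J.IsSymm) (hC : C.PosSemidef)
    (hτ : ∀ i, 0 < τ i) (hinj : Function.Injective τ)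
    (hker : ∀ i, (P₁ + τ i • P₂ + τ i ^ 2 • J + τ i ^ 4 • C) *ᵥ u i = 0)
    (htype : ∀ i, 2 * (u i ⬝ᵥ (P₁ *ᵥ u i)) + τ i * (u i ⬝ᵥ (P₂ *ᵥ u i)) < 2 * τ i ^ 4 * (u i ⬝ᵥ (C *ᵥ u i))) :
    Fintype.card I ≤ C.rank := by
  refine card_negType_le_rank_four_letters C J (fun i => (τ i)⁻¹) u P₂ P₁ hC hJ hP₂ hP₁
    (fun i => inv_pos.mpr (hτ i)) (fun i k hik => hinj (inv_injective hik)) ?_ ?_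
  · intro i
    have hτi : τ i ≠ 0 := ne_of_gt (hτ i)
    have h := congrArg (fun w => ((τ i)⁻¹) ^ 4 • w) (hker i)
    simp only [smul_zero] at h
    rw [← h, ← Matrix.smul_mulVec]
    congr 1
    have e1 : (τ i)⁻¹ ^ 4 * τ i = (τ i)⁻¹ ^ 3 := by field_simp
    have e2 : (τ i)⁻¹ ^ 4 * τ i ^ 2 = (τ i)⁻¹ ^ 2 := by field_simp
    have e4 : (τ i)⁻¹ ^ 4 * τ i ^ 4 = 1 := by field_simp
    rw [smul_add, smul_add, smul_add, smul_smul, smul_smul, smul_smul, e1, e2, e4, one_smul]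
    abel
  · intro i
    have hτi := hτ i
    have ht := htype i
    have hpow : 0 < (τ i)⁻¹ ^ 4 := pow_pos (inv_pos.mpr hτi) _
    -- multiply the type inequality by `τ⁻⁴`
    have h1 := mul_lt_mul_of_pos_left ht hpow
    have e0 : (τ i)⁻¹ ^ 4 * (2 * τ i ^ 4 * (u i ⬝ᵥ (C *ᵥ u i))) = 2 * (u i ⬝ᵥ (C *ᵥ u i)) := by
      field_simp
    have e1 : (τ i)⁻¹ ^ 4 * (2 * (u i ⬝ᵥ (P₁ *ᵥ u i)) + τ i * (u i ⬝ᵥ (P₂ *ᵥ u i)))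
        = (τ i)⁻¹ ^ 3 * (u i ⬝ᵥ (P₂ *ᵥ u i)) + 2 * (τ i)⁻¹ ^ 4 * (u i ⬝ᵥ (P₁ *ᵥ u i)) := by
      field_simp
      ring
    rw [e0, e1] at h1
    exact h1

end ClusteredLower

end TwoSidedThree

end Summit.ValiantsHypothesis.ValiantsHypothesis.Theorems.KPlusLogSqLaw.TowerGraft
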